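import Literature.Computability.ImplicitComplexity.SoftTypeAssignmentLeftmost
import Literature.Computability.ImplicitComplexity.STAConfluence
import HarnessLib

/-!
# Parallel `β`-reduction for `Λ₊`, confluence of `β`, and commutation with choices

Rewriting theory of the term calculus `Λ₊` of `STA₊` (GMR08 = Gaboardi–Marion–Ronchi Della
Rocca 2008, Def. 5.1–5.2: `λ`-terms with the nondeterministic sum `M + N →γ M`, `M + N →γ N`)
used in the NP-completeness half of `STAPlusCapturesNP`:

* `STA.RedB` / `STA.BetaReduces` — `β`-steps only (anywhere, also inside sums), and their
  reflexive-transitive closure;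
* the parallel `β`-reduction `STA.Par` of `STAConfluence.lean` (Tait–Martin-Löf–Takahashi,
  `+` an inert constructor, triangle and diamond properties proved there) is `→β*` up to
  closure, whence **confluence of `β`** on all of `Λ₊` (`BetaReduces.cr`);
* `Par.commute_red` — a parallel `β`-step commutes with every `βγ`-step (a contracted choice
  has finitely many residuals, each resolved the same way), whence
  `Reduces.of_betaReduces` : if `M →βγ* N` with `N` normal and `M →β* M'`, then `M' →βγ* N`
  (**`β`-steps can always be advanced** without losing any reachable normal form);
* on sum-free terms `→βγ` is `→β`, so normal forms of sum-free terms are unique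
  (`Reduces.unique_normal_of_sumFree`).

## References

* M. Takahashi, *Parallel reductions in λ-calculus*, Inform. and Comput. 118 (1995) 120–127, §1.
* [GaboardiMarionRonchidellarocca2008] Def. 5.1, Def. 5.2.
* H. P. Barendregt, *The Lambda Calculus*, North-Holland 1984, §3.2, §11.1 (Hindley–Rosen).
-/

namespace Literature.Computability.ImplicitComplexity

namespace STA

/-! ### `β`-steps only -/

/-- One `β`-step anywhere in a `Λ₊` term (no choice step). [cite: GaboardiMarionRonchidellarocca2008, Def. 5.2] -/
inductive RedB : Term → Term → Prop
  | beta (M N : Term) : RedB (.app (.lam M) N) (M.subst0 N)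
  | appL {M M' : Term} (N : Term) (h : RedB M M') : RedB (.app M N) (.app M' N)
  | appR (M : Term) {N N' : Term} (h : RedB N N') : RedB (.app M N) (.app M N')
  | lam {M M' : Term} (h : RedB M M') : RedB (.lam M) (.lam M')
  | sumL {M M' : Term} (N : Term) (h : RedB M M') : RedB (.sum M N) (.sum M' N)
  | sumR (M : Term) {N N' : Term} (h : RedB N N') : RedB (.sum M N) (.sum M N')

/-- `→β*`. [folklore] -/
def BetaReduces : Term → Term → Prop := Relation.ReflTransGen RedB

/-- A `β`-step is a `βγ`-step. [folklore] -/
theorem RedB.red {M N : Term} (h : RedB M N) : Red M N := by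
  induction h with
  | beta M N => exact Red.beta M N
  | appL N _ ih => exact Red.appL N ih
  | appR M _ ih => exact Red.appR M ih
  | lam _ ih => exact Red.lam ih
  | sumL N _ ih => exact Red.sumL N ih
  | sumR M _ ih => exact Red.sumR M ih

/-- On a sum-free term every `βγ`-step is a `β`-step. [folklore] -/
theorem Red.redB_of_sumFree {M N : Term} (h : Red M N) (hM : M.SumFree) : RedB M N := by
  induction h with
  | beta M N => exact RedB.beta M N
  | choiceL M N => exact hM.elim
  | choiceR M N => exact hM.elim
  | appL N _ ih => exact RedB.appL N (ih hM.1)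
  | appR M _ ih => exact RedB.appR M (ih hM.2)
  | lam _ ih => exact RedB.lam (ih hM)
  | sumL N _ _ => exact hM.elim
  | sumR M _ _ => exact hM.elim

namespace BetaReduces

/-- `→β* ⊆ →βγ*`. [folklore] -/
theorem reduces {M N : Term} (h : BetaReduces M N) : Reduces M N := by
  induction h with
  | refl => exact Relation.ReflTransGen.refl
  | tail _ hst ih => exact ih.tail hst.red

/-- On sum-free terms `→βγ*` is `→β*`. [folklore] -/
theorem of_reduces_sumFree {M N : Term} (h : Reduces M N) (hM : M.SumFree) : BetaReduces M N := by
  induction h with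
  | refl => exact Relation.ReflTransGen.refl
  | tail hMN hst ih => exact (ih).tail (hst.redB_of_sumFree (Reduces.sumFree hMN hM))

/-- Reflexivity of `→β*`. [folklore] -/
theorem rfl' (M : Term) : BetaReduces M M := Relation.ReflTransGen.refl

/-- Transitivity of `→β*`. [folklore] -/
theorem trans' {M N P : Term} (h₁ : BetaReduces M N) (h₂ : BetaReduces N P) : BetaReduces M P :=
  Relation.ReflTransGen.trans h₁ h₂

/-- One step. [folklore] -/
theorem single {M N : Term} (h : RedB M N) : BetaReduces M N := Relation.ReflTransGen.single h

/-- Congruence: function part. [folklore] -/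
theorem appL {M M' : Term} (h : BetaReduces M M') (N : Term) : BetaReduces (.app M N) (.app M' N) := by
  induction h with
  | refl => exact Relation.ReflTransGen.refl
  | tail _ hst ih => exact ih.tail (RedB.appL N hst)

/-- Congruence: argument part. [folklore] -/
theorem appR (M : Term) {N N' : Term} (h : BetaReduces N N') : BetaReduces (.app M N) (.app M N') := by
  induction h with
  | refl => exact Relation.ReflTransGen.refl
  | tail _ hst ih => exact ih.tail (RedB.appR M hst)

/-- Congruence: application. [folklore] -/
theorem app {M M' N N' : Term} (hM : BetaReduces M M') (hN : BetaReduces N N') :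
    BetaReduces (.app M N) (.app M' N') := (hM.appL N).trans' (appR M' hN)

/-- Congruence: abstraction. [folklore] -/
theorem lam {M M' : Term} (h : BetaReduces M M') : BetaReduces (.lam M) (.lam M') := by
  induction h with
  | refl => exact Relation.ReflTransGen.refl
  | tail _ hst ih => exact ih.tail (RedB.lam hst)

/-- Congruence: sum. [folklore] -/
theorem sum {M M' N N' : Term} (hM : BetaReduces M M') (hN : BetaReduces N N') :
    BetaReduces (.sum M N) (.sum M' N') := by
  have h1 : BetaReduces (.sum M N) (.sum M' N) := by
    induction hM with
    | refl => exact Relation.ReflTransGen.refl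
    | tail _ hst ih => exact ih.tail (RedB.sumL N hst)
  refine h1.trans' ?_
  induction hN with
  | refl => exact Relation.ReflTransGen.refl
  | tail _ hst ih => exact ih.tail (RedB.sumR M' hst)

/-- A `β`-redex contracts after reducing its parts. [folklore] -/
theorem beta {M M' N N' : Term} (hM : BetaReduces M M') (hN : BetaReduces N N') :
    BetaReduces (.app (.lam M) N) (M'.subst0 N') :=
  ((app (lam hM) hN).tail (RedB.beta M' N'))

end BetaReduces

/-! ### Parallel reduction is `→β*` up to closure -/

namespace Par

/-- A single `β`-step is a parallel step. [folklore] -/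
theorem of_redB {M N : Term} (h : RedB M N) : Par M N := by
  induction h with
  | beta M N => exact Par.beta (Par.refl M) (Par.refl N)
  | appL N _ ih => exact Par.app ih (Par.refl N)
  | appR M _ ih => exact Par.app (Par.refl M) ih
  | lam _ ih => exact Par.lam ih
  | sumL N _ ih => exact Par.sum ih (Par.refl N)
  | sumR M _ ih => exact Par.sum (Par.refl M) ih

/-- A parallel step is a sequence of `β`-steps. [folklore] -/
theorem betaReduces {M N : Term} (h : Par M N) : BetaReduces M N := by
  induction h with
  | var i => exact Relation.ReflTransGen.refl
  | app _ _ ihM ihN => exact BetaReduces.app ihM ihN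
  | lam _ ih => exact BetaReduces.lam ih
  | sum _ _ ihM ihN => exact BetaReduces.sum ihM ihN
  | beta _ _ ihM ihN => exact BetaReduces.beta ihM ihN

/-- Inversion: a parallel reduct of an abstraction is an abstraction. [folklore] -/
theorem lam_inv {M X : Term} (h : Par (.lam M) X) : ∃ M', X = .lam M' ∧ Par M M' := by
  cases h with
  | lam h => exact ⟨_, rfl, h⟩

/-- Inversion: a parallel reduct of a sum is a sum of reducts. [folklore] -/
theorem sum_inv {M N X : Term} (h : Par (.sum M N) X) : ∃ M' N', X = .sum M' N' ∧ Par M M' ∧ Par N N' := by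
  cases h with
  | sum hM hN => exact ⟨_, _, rfl, hM, hN⟩

end Par

/-! ### Confluence of `β` -/

/-- `⇒*`, finitely many parallel steps (the same relation as `→β*`). [folklore] -/
def ParStar : Term → Term → Prop := Relation.ReflTransGen Par

/-- `⇒* = →β*`. [folklore] -/
theorem parStar_iff_betaReduces {M N : Term} : ParStar M N ↔ BetaReduces M N := by
  constructor
  · intro h
    induction h with
    | refl => exact Relation.ReflTransGen.refl
    | tail _ hst ih => exact ih.trans' hst.betaReduces
  · intro h
    induction h with
    | refl => exact Relation.ReflTransGen.refl
    | tail _ hst ih => exact Relation.ReflTransGen.tail ih (Par.of_redB hst)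

/-- Strip lemma: one parallel step against many. [folklore] -/
theorem Par.strip {M N₁ N₂ : Term} (h₁ : Par M N₁) (h₂ : ParStar M N₂) : ∃ P, ParStar N₁ P ∧ Par N₂ P := by
  induction h₂ with
  | refl => exact ⟨N₁, Relation.ReflTransGen.refl, h₁⟩
  | tail _ hst ih =>
    obtain ⟨P, hP1, hP2⟩ := ih
    obtain ⟨Q, hQ1, hQ2⟩ := Par.diamond hP2 hst
    exact ⟨Q, hP1.tail hQ1, hQ2⟩

/-- **Confluence of `⇒*`.** [folklore] -/
theorem ParStar.cr {M N₁ N₂ : Term} (h₁ : ParStar M N₁) (h₂ : ParStar M N₂) : ∃ P, ParStar N₁ P ∧ ParStar N₂ P := by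
  induction h₁ with
  | refl => exact ⟨N₂, h₂, Relation.ReflTransGen.refl⟩
  | tail _ hst ih =>
    obtain ⟨P, hP1, hP2⟩ := ih
    obtain ⟨Q, hQ1, hQ2⟩ := hst.strip hP1
    exact ⟨Q, hQ1, hP2.tail hQ2⟩

/-- **Church–Rosser for `β` on `Λ₊`.** [folklore] -/
theorem BetaReduces.cr {M N₁ N₂ : Term} (h₁ : BetaReduces M N₁) (h₂ : BetaReduces M N₂) :
    ∃ P, BetaReduces N₁ P ∧ BetaReduces N₂ P := by
  obtain ⟨P, hP1, hP2⟩ := ParStar.cr (parStar_iff_betaReduces.2 h₁) (parStar_iff_betaReduces.2 h₂)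
  exact ⟨P, parStar_iff_betaReduces.1 hP1, parStar_iff_betaReduces.1 hP2⟩

/-- A normal term has no `β`-reduct. [folklore] -/
theorem Normal.eq_of_betaReduces {M N : Term} (hM : Normal M) (h : BetaReduces M N) : N = M := by
  induction h with
  | refl => rfl
  | tail _ hst ih => subst ih; exact absurd hst.red (hM _)

/-- **Uniqueness of normal forms for sum-free terms.** [folklore] -/
theorem Reduces.unique_normal_of_sumFree {M N₁ N₂ : Term} (hM : M.SumFree) (h₁ : Reduces M N₁) (h₂ : Reduces M N₂)
    (hN₁ : Normal N₁) (hN₂ : Normal N₂) : N₁ = N₂ := by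
  obtain ⟨P, hP1, hP2⟩ := BetaReduces.cr (BetaReduces.of_reduces_sumFree h₁ hM) (BetaReduces.of_reduces_sumFree h₂ hM)
  rw [← hN₁.eq_of_betaReduces hP1, ← hN₂.eq_of_betaReduces hP2]

/-! ### Commutation of parallel `β`-steps with `βγ`-steps -/

/-- Inversion of `→βγ` at an abstraction. [folklore] -/
theorem Red.lam_inv {M X : Term} (h : Red (.lam M) X) : ∃ M', X = .lam M' ∧ Red M M' := by
  cases h with
  | lam h => exact ⟨_, rfl, h⟩

/-- Inversion of `→βγ*` at an abstraction. [folklore] -/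
theorem Reduces.lam_inv {M X : Term} (h : Reduces (.lam M) X) : ∃ M', X = .lam M' ∧ Reduces M M' := by
  induction h with
  | refl => exact ⟨M, rfl, Relation.ReflTransGen.refl⟩
  | tail _ hst ih =>
    obtain ⟨M', rfl, hM'⟩ := ih
    obtain ⟨M'', rfl, hM''⟩ := hst.lam_inv
    exact ⟨M'', rfl, hM'.tail hM''⟩

/-- **A parallel `β`-step commutes with a `βγ`-step**: the `βγ`-step has a parallel residual
after the parallel step, reached by finitely many `βγ`-steps (for a choice step: one choice per
residual copy of the contracted sum). [folklore] -/
theorem Par.commute_red {M M' N : Term} (hp : Par M M') (hr : Red M N) : ∃ N', Par N N' ∧ Reduces M' N' := by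
  induction hr generalizing M' with
  | beta A B =>
    cases hp with
    | app hM hN =>
      obtain ⟨A', rfl, hA⟩ := hM.lam_inv
      exact ⟨_, hA.subst0 hN, Reduces.single (Red.beta _ _)⟩
    | beta hM hN => exact ⟨_, hM.subst0 hN, Relation.ReflTransGen.refl⟩
  | choiceL A B =>
    obtain ⟨A', B', rfl, hA, hB⟩ := hp.sum_inv
    exact ⟨A', hA, Reduces.single (Red.choiceL _ _)⟩
  | choiceR A B =>
    obtain ⟨A', B', rfl, hA, hB⟩ := hp.sum_inv
    exact ⟨B', hB, Reduces.single (Red.choiceR _ _)⟩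
  | appL B hA ih =>
    cases hp with
    | app hM hN =>
      obtain ⟨P, hP1, hP2⟩ := ih hM
      exact ⟨_, Par.app hP1 hN, hP2.appL _ |>.trans' (Reduces.appR _ Relation.ReflTransGen.refl)⟩
    | beta hM hN =>
      rename_i A A' B'
      obtain ⟨A₁, rfl, hA₁⟩ := hA.lam_inv
      obtain ⟨P, hP1, hP2⟩ := ih (Par.lam hM)
      obtain ⟨P', rfl, hPP'⟩ := hP1.lam_inv
      obtain ⟨P'', hP'', hred⟩ := hP2.lam_inv
      simp only [Term.lam.injEq] at hP''
      subst hP''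
      exact ⟨_, Par.beta hPP' hN, Reduces.subst0 hred Relation.ReflTransGen.refl⟩
  | appR A hB ih =>
    cases hp with
    | app hM hN =>
      obtain ⟨P, hP1, hP2⟩ := ih hN
      exact ⟨_, Par.app hM hP1, Reduces.appR _ hP2⟩
    | beta hM hN =>
      obtain ⟨P, hP1, hP2⟩ := ih hN
      exact ⟨_, Par.beta hM hP1, Reduces.subst0 Relation.ReflTransGen.refl hP2⟩
  | lam hA ih =>
    obtain ⟨A', rfl, hA'⟩ := hp.lam_inv
    obtain ⟨P, hP1, hP2⟩ := ih hA'
    exact ⟨_, Par.lam hP1, Reduces.lam hP2⟩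
  | sumL B hA ih =>
    obtain ⟨A', B', rfl, hA', hB'⟩ := hp.sum_inv
    obtain ⟨P, hP1, hP2⟩ := ih hA'
    exact ⟨_, Par.sum hP1 hB', Reduces.sumL hP2 _⟩
  | sumR A hB ih =>
    obtain ⟨A', B', rfl, hA', hB'⟩ := hp.sum_inv
    obtain ⟨P, hP1, hP2⟩ := ih hB'
    exact ⟨_, Par.sum hA' hP1, Reduces.sumR _ hP2⟩

/-- A parallel `β`-step commutes with `→βγ*`. [folklore] -/
theorem Par.commute_reduces {M M' N : Term} (hp : Par M M') (hr : Reduces M N) : ∃ N', Par N N' ∧ Reduces M' N' := by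
  induction hr generalizing M' with
  | refl => exact ⟨M', hp, Relation.ReflTransGen.refl⟩
  | tail _ hst ih =>
    obtain ⟨P, hP1, hP2⟩ := ih hp
    obtain ⟨Q, hQ1, hQ2⟩ := hP1.commute_red hst
    exact ⟨Q, hQ1, hP2.trans' hQ2⟩

/-- `→β*` commutes with `→βγ*` up to `⇒*`. [folklore] -/
theorem BetaReduces.commute_reduces {M M' N : Term} (hb : BetaReduces M M') (hr : Reduces M N) :
    ∃ N', ParStar N N' ∧ Reduces M' N' := by
  induction hb generalizing N with
  | refl => exact ⟨N, Relation.ReflTransGen.refl, hr⟩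
  | tail _ hst ih =>
    obtain ⟨P, hP1, hP2⟩ := ih hr
    obtain ⟨Q, hQ1, hQ2⟩ := (Par.of_redB hst).commute_reduces hP2
    exact ⟨Q, hP1.tail hQ1, hQ2⟩

/-- A normal term only parallel-reduces to itself. [folklore] -/
theorem Normal.eq_of_par {M N : Term} (hM : Normal M) (h : Par M N) : N = M :=
  hM.eq_of_betaReduces h.betaReduces

/-- A normal term only `⇒*`-reduces to itself. [folklore] -/
theorem Normal.eq_of_parStar {M N : Term} (hM : Normal M) (h : ParStar M N) : N = M :=
  hM.eq_of_betaReduces (parStar_iff_betaReduces.1 h)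

/-- **`β`-steps can be advanced**: if `M` reaches the normal form `N` and `M →β* M'`, then `M'`
still reaches `N`. [folklore] -/
theorem Reduces.of_betaReduces {M M' N : Term} (hr : Reduces M N) (hN : Normal N) (hb : BetaReduces M M') :
    Reduces M' N := by
  obtain ⟨N', hN', hM'⟩ := hb.commute_reduces hr
  rwa [hN.eq_of_parStar hN'] at hM'

/-- **Reachability of a normal form is invariant under `β`-conversion steps forward**:
`M →β* M'` implies (`M →βγ* N ↔ M' →βγ* N`) for normal `N`. [folklore] -/
theorem BetaReduces.reduces_normal_iff {M M' N : Term} (hb : BetaReduces M M') (hN : Normal N) :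
    Reduces M N ↔ Reduces M' N :=
  ⟨fun hr => hr.of_betaReduces hN hb, fun hr => hb.reduces.trans hr⟩

end STA

end Literature.Computability.ImplicitComplexity
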